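import Mathlib.Analysis.Calculus.Deriv.Basic
import Mathlib.Analysis.Calculus.FDeriv.Measurable
import Mathlib.MeasureTheory.Integral.DominatedConvergence
import Mathlib.MeasureTheory.Integral.IntervalIntegral.FundThmCalculus
import Mathlib.Analysis.SpecialFunctions.Integrals.Basic
import HarnessLib

/-!
# Passing the adapted frequency to a pointwise limit of enstrophies
# (route `AdaptedFrequency`, item `TangentFlowTransfer`, stmt-NavierStokesRegularity-10494)

Helper file (all results proved; pure real analysis). In the last step of the Type-I compactness
transfer `TangentFlowTransfer` one has, along the blow-up sequence, the zoomed adapted enstrophies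
`H_k` and the limit enstrophy `H̄` of the tangent flow on an open time interval `U ⊆ (−∞, 0)` with

* `H_k → H̄` and `H_k′ → g` pointwise on `U` (dominated convergence of `∫ ‖ω_k‖² G_k` and of the
  kernel-calculus formula for `H_k′`), with `|H_k′| ≤ B` on `U` uniformly in `k` and `g` continuous;
* the scale-invariant frequencies `Λ_k(τ) = (0 − τ) H_k′(τ)/H_k(τ) = Λ(T + c_k² τ) → Λ₀`
  (`tendsto_adaptedFrequency_zoom_seq` of the companion file `…ZoomFrequency`).

This file turns these into the conclusion of the item: `H̄` is differentiable on `U` with `H̄′ = g`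
(`hasDerivAt_of_tendsto_of_deriv_bound`: FTC for each `H_k`, dominated convergence in time, FTC for
the continuous `g`), and wherever `H̄(τ) ≠ 0` the limit frequency is the constant `Λ₀`
(`limit_frequency_eq`): `(0 − τ) H̄′(τ)/H̄(τ) = lim Λ_k(τ) = Λ₀`.

References: C.-C. Poon, Comm. PDE 21 (1996) (parabolic frequency); G. Koch, N. Nadirashvili,
G. Seregin, V. Šverák, Acta Math. 203 (2009), §6 (blow-up limits).
-/

noncomputable section

open MeasureTheory Set Function Filter TopologicalSpace Metric intervalIntegral
open scoped Topology

namespace Summit.NavierStokesRegularity.NavierStokesRegularity.Theorems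

/-- **FTC transfer of derivatives to a pointwise limit.** Let `U` be open, `H k : ℝ → ℝ`
differentiable at every point of `U` with `|deriv (H k) τ| ≤ B` for `τ ∈ U` (uniformly in `k`),
`H k τ → Hbar τ` and `deriv (H k) τ → g τ` for every `τ ∈ U`, with `g` continuous on `U`. Then
`Hbar` has derivative `g τ` at every `τ ∈ U` (on an interval `[τ₁, τ₂] ⊆ U`:
`H k τ₂ − H k τ₁ = ∫_{τ₁}^{τ₂} (H k)′ → ∫_{τ₁}^{τ₂} g` by dominated convergence, so
`Hbar τ = Hbar τ₁ + ∫_{τ₁}^{τ} g` near `τ`, and the right-hand side has derivative `g τ`). [folklore] -/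
theorem hasDerivAt_of_tendsto_of_deriv_bound {U : Set ℝ} (hU : IsOpen U) {H : ℕ → ℝ → ℝ}
    {Hbar g : ℝ → ℝ} {B : ℝ}
    (hdiff : ∀ k, ∀ τ ∈ U, DifferentiableAt ℝ (H k) τ)
    (hbound : ∀ k, ∀ τ ∈ U, |deriv (H k) τ| ≤ B)
    (hH : ∀ τ ∈ U, Tendsto (fun k => H k τ) atTop (𝓝 (Hbar τ)))
    (hg : ∀ τ ∈ U, Tendsto (fun k => deriv (H k) τ) atTop (𝓝 (g τ)))
    (hgc : ContinuousOn g U) {τ : ℝ} (hτ : τ ∈ U) : HasDerivAt Hbar (g τ) τ := by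
  -- an interval `[τ - δ, τ + δ] ⊆ U`
  obtain ⟨δ, hδ, hball⟩ := Metric.isOpen_iff.1 hU τ hτ
  have hIcc : Icc (τ - δ / 2) (τ + δ / 2) ⊆ U := fun s hs => hball <| by
    rw [Metric.mem_ball, Real.dist_eq, abs_lt]; constructor <;> linarith [hs.1, hs.2]
  set a := τ - δ / 2 with ha
  -- FTC for each `H k` on subintervals of `[a, τ + δ/2]`
  have hFTC : ∀ k, ∀ s ∈ Icc (τ - δ / 2) (τ + δ / 2),
      ∫ r in a..s, deriv (H k) r = H k s - H k a := by
    intro k s hs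
    have hsub : uIcc a s ⊆ U := by
      rw [uIcc_of_le (by rw [ha]; exact hs.1)]
      exact (Icc_subset_Icc le_rfl hs.2).trans hIcc
    refine integral_eq_sub_of_hasDerivAt (fun r hr => (hdiff k r (hsub hr)).hasDerivAt) ?_
    -- the derivative is bounded and measurable, hence interval integrable
    refine IntervalIntegrable.mono_fun' (g := fun _ => B) intervalIntegrable_const
      (measurable_deriv (H k)).aestronglyMeasurable ?_
    rw [Filter.EventuallyLE, ae_restrict_iff' measurableSet_uIoc]
    refine Eventually.of_forall fun r hr => ?_
    rw [Real.norm_eq_abs]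
    exact hbound k r (hsub (uIoc_subset_uIcc hr))
  -- dominated convergence in time: `∫_a^s (H k)′ → ∫_a^s g`
  have hDCT : ∀ s ∈ Icc (τ - δ / 2) (τ + δ / 2),
      Tendsto (fun k => ∫ r in a..s, deriv (H k) r) atTop (𝓝 (∫ r in a..s, g r)) := by
    intro s hs
    have hsub : uIcc a s ⊆ U := by
      rw [uIcc_of_le (by rw [ha]; exact hs.1)]
      exact (Icc_subset_Icc le_rfl hs.2).trans hIcc
    refine intervalIntegral.tendsto_integral_filter_of_dominated_convergence (fun _ => B) ?_ ?_
      intervalIntegrable_const ?_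
    · exact Eventually.of_forall fun k => (measurable_deriv (H k)).aestronglyMeasurable
    · refine Eventually.of_forall fun k => Eventually.of_forall fun r hr => ?_
      rw [Real.norm_eq_abs]
      exact hbound k r (hsub (uIoc_subset_uIcc hr))
    · exact Eventually.of_forall fun r hr => hg r (hsub (uIoc_subset_uIcc hr))
  -- hence `Hbar s = Hbar a + ∫_a^s g` on the interval
  have hlim : ∀ s ∈ Icc (τ - δ / 2) (τ + δ / 2), Hbar s = Hbar a + ∫ r in a..s, g r := by
    intro s hs
    have h1 : Tendsto (fun k => H k s - H k a) atTop (𝓝 (∫ r in a..s, g r)) := by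
      refine (hDCT s hs).congr fun k => ?_
      exact hFTC k s hs
    have h2 : Tendsto (fun k => H k s - H k a) atTop (𝓝 (Hbar s - Hbar a)) :=
      (hH s (hIcc hs)).sub (hH a (hIcc ⟨le_rfl, by linarith⟩))
    have := tendsto_nhds_unique h2 h1
    linarith
  -- FTC for the continuous `g`
  have hτI : τ ∈ Icc (τ - δ / 2) (τ + δ / 2) := ⟨by linarith, by linarith⟩
  have hgi : IntervalIntegrable g volume a τ := by
    refine (hgc.mono ?_).intervalIntegrable
    rw [uIcc_of_le (by rw [ha]; exact hτI.1)]
    exact (Icc_subset_Icc le_rfl hτI.2).trans hIcc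
  have hF : HasDerivAt (fun s => ∫ r in a..s, g r) (g τ) τ :=
    integral_hasDerivAt_right hgi (hgc.stronglyMeasurableAtFilter hU τ hτ)
      (hgc.continuousAt (hU.mem_nhds hτ))
  have hF' : HasDerivAt (fun s => Hbar a + ∫ r in a..s, g r) (g τ) τ := by
    simpa using hF.const_add (Hbar a)
  -- `Hbar` agrees with that primitive near `τ`
  refine hF'.congr_of_eventuallyEq ?_
  have hnhds : Icc (τ - δ / 2) (τ + δ / 2) ∈ 𝓝 τ := Icc_mem_nhds (by linarith) (by linarith)
  filter_upwards [hnhds] with s hs using hlim s hs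

/-- **The limit frequency is the limit of the frequencies.** In the setting of
`hasDerivAt_of_tendsto_of_deriv_bound`, if moreover the frequencies
`(T₀ − τ) · deriv (H k) τ / H k τ` converge to `Λ₀` at some `τ ∈ U` with `Hbar τ ≠ 0`, then
`(T₀ − τ) · deriv Hbar τ / Hbar τ = Λ₀` (uniqueness of limits; `deriv Hbar τ = g τ`). For the item
`TangentFlowTransfer`: `T₀ = 0`, `H k` the zoomed adapted enstrophies along the blow-up sequence,
whose frequencies at `τ` equal `Λ(T + c_k² τ) → Λ₀`. [folklore] -/
theorem limit_frequency_eq {U : Set ℝ} (hU : IsOpen U) {H : ℕ → ℝ → ℝ} {Hbar g : ℝ → ℝ} {B : ℝ}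
    (hdiff : ∀ k, ∀ τ ∈ U, DifferentiableAt ℝ (H k) τ)
    (hbound : ∀ k, ∀ τ ∈ U, |deriv (H k) τ| ≤ B)
    (hH : ∀ τ ∈ U, Tendsto (fun k => H k τ) atTop (𝓝 (Hbar τ)))
    (hg : ∀ τ ∈ U, Tendsto (fun k => deriv (H k) τ) atTop (𝓝 (g τ)))
    (hgc : ContinuousOn g U) {τ : ℝ} (hτ : τ ∈ U) (hne : Hbar τ ≠ 0) {T₀ Λ₀ : ℝ}
    (hΛ : Tendsto (fun k => (T₀ - τ) * deriv (H k) τ / H k τ) atTop (𝓝 Λ₀)) :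
    (T₀ - τ) * deriv Hbar τ / Hbar τ = Λ₀ := by
  have hD : deriv Hbar τ = g τ := (hasDerivAt_of_tendsto_of_deriv_bound hU hdiff hbound hH hg hgc hτ).deriv
  have h1 : Tendsto (fun k => (T₀ - τ) * deriv (H k) τ / H k τ) atTop
      (𝓝 ((T₀ - τ) * g τ / Hbar τ)) :=
    ((hg τ hτ).const_mul (T₀ - τ)).div (hH τ hτ) hne
  rw [hD]
  exact (tendsto_nhds_unique hΛ h1).symm

/-- **Positivity and constancy of the limit frequency, in the shape of the item.** If in addition
`Hbar > 0` on `U` and the frequencies converge to `Λ₀` at every `τ ∈ U`, then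
`(T₀ − τ) · deriv Hbar τ / Hbar τ = Λ₀` for every `τ ∈ U`. [folklore] -/
theorem limit_frequency_eq_forall {U : Set ℝ} (hU : IsOpen U) {H : ℕ → ℝ → ℝ} {Hbar g : ℝ → ℝ}
    {B : ℝ} (hdiff : ∀ k, ∀ τ ∈ U, DifferentiableAt ℝ (H k) τ)
    (hbound : ∀ k, ∀ τ ∈ U, |deriv (H k) τ| ≤ B)
    (hH : ∀ τ ∈ U, Tendsto (fun k => H k τ) atTop (𝓝 (Hbar τ)))
    (hg : ∀ τ ∈ U, Tendsto (fun k => deriv (H k) τ) atTop (𝓝 (g τ)))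
    (hgc : ContinuousOn g U) (hpos : ∀ τ ∈ U, 0 < Hbar τ) {T₀ Λ₀ : ℝ}
    (hΛ : ∀ τ ∈ U, Tendsto (fun k => (T₀ - τ) * deriv (H k) τ / H k τ) atTop (𝓝 Λ₀)) :
    ∀ τ ∈ U, (T₀ - τ) * deriv Hbar τ / Hbar τ = Λ₀ := fun τ hτ =>
  limit_frequency_eq hU hdiff hbound hH hg hgc hτ (hpos τ hτ).ne' (hΛ τ hτ)

end Summit.NavierStokesRegularity.NavierStokesRegularity.Theorems

end
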